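import Summits.HodgeConjecture.HodgeConjecture.Theses.EndoscopicMiddleDegree
import Summits.HodgeConjecture.HodgeConjecture.Theorems.EndoscopicMiddleDegreeAlgebraicOrEnvelopedOfSplit
import Summits.HodgeConjecture.HodgeConjecture.Theorems.EndoscopicMiddleDegreeOrthogonalSplitOfFacts

/-!
# Line `pieces-split` — crux `EndoscopicMiddleDegree.AlgebraicOrEnveloped` (stmt-HodgeConjecture-14943)

BC2-REDIRECT DECOMPOSITION LINE (crux-strategist, route re-audit 2026-08-17).  The rank-5 crux
`AlgebraicOrEnveloped` (THE DICHOTOMY: given HC in degree `2m` on a compact `2(m+1)`-ball quotient,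
every rational Hodge `(m+1,m+1)`-class is algebraic modulo correspondence-enveloped rational classes) is a
PACKAGING node: it was introduced in rev 11 so that the deciding theorem `closes` binds cruxes only.  Its
content is the route's own typed decomposition

  `CupProductAlgebraic ∧ OrthogonalSplit ∧ OrthogonalEnveloped ⟹ AlgebraicOrEnveloped`,

assembled by the LANDED glue `algebraicOrEnvelopedOfSplit_proof` (item stmt-HodgeConjecture-14944,
`Theorems/EndoscopicMiddleDegreeAlgebraicOrEnvelopedOfSplit.lean`, 32 tactic lines) whose middle piece is
the LANDED theorem `orthogonalSplit_proof` (item stmt-HodgeConjecture-14299, hard Lefschetz + Hodge–Riemann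
+ "algebraic classes are Hodge classes", `Theorems/EndoscopicMiddleDegreeOrthogonalSplitOfFacts.lean`).
Discharging the proved piece leaves exactly TWO open pieces, which are this line's two registered stubs —
each of them verbatim an EXISTING item of the route, so closing the item closes the stub:

* `stub_cupProductAlgebraic`  = item stmt-HodgeConjecture-14350 `CupProductAlgebraic` (support, KNOWN:
  Fulton §19.2 / Voisin II Prop. 9.20; provable-now, L-sized; in-tree reductions
  `cupProductAlgebraic_of_span_chernCharacter`, `cupProductAlgebraic_of_moving_irreducible`);
* `stub_orthogonalEnveloped` = item stmt-HodgeConjecture-14300 `OrthogonalEnveloped` (crux #4, THE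
  AUTOMORPHIC HEART; HC-implied, strictly weaker than the summit; its own chain reduced it to the bet
  `CoreVanishing`, landed `orthogonalEnveloped_of_coreVanishing`).

`AlgebraicOrEnveloped_of` below is the kernel-checked composition concluding the crux BY NAME; it is the
`--glue-by` theorem of the split `AlgebraicOrEnveloped ⟸ CupProductAlgebraic, OrthogonalEnveloped`
(children.json attached as evidence; `route edit --split` itself is refused to non-final-cycle seats by the
gate, rule split.final-cycle-only, and is left to the tenure planner / operator).

Disproof used: `Cruxes/AlgebraicOrEnveloped/Disproof.lean` F1 (no kill short of ¬HC: the crux is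
HC-implied, landed `Negative/Calibration.not_hodgeConjecture_of_not_crux`), F2/F3 (orientation family and
algebraicity of γ are supplied on the Theorems side — here inside `algebraicOrEnvelopedOfSplit_proof`).
No stub is an instance refuted by a landed Negative lemma (both stubs are HC-implied or known theorems).
-/

-- mandated `Summit.HodgeConjecture.HodgeConjecture.…` namespace (single-problem summit) trips `linter.dupNamespace`;
-- off tree-wide in the lakefile, restated for stand-alone elaboration.
set_option linter.dupNamespace false

namespace Summit.HodgeConjecture.HodgeConjecture.Cruxes.AlgebraicOrEnveloped.PiecesSplit

open Summit.HodgeConjecture.HodgeConjecture.Theses.EndoscopicMiddleDegree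
open Summit.HodgeConjecture.HodgeConjecture.Theorems

/-- **Stub 1 (support-sized, KNOWN; = item stmt-HodgeConjecture-14350 `CupProductAlgebraic`).** On a smooth
projective `X/ℂ`, cup products of algebraic classes are algebraic:
`Nˡ H²ˡ ∪ Nᵏ H²ᵏ ⊆ N^{l+k} H^{2(l+k)}` (Fulton §19.2 with the moving lemma §11.4; Voisin II Prop. 9.20).
Load-bearing for the Lefschetz summand `Hdg^{m,m}_ℚ · N¹` of the theta world.  Close it by closing the
item (in-tree: `cupProductAlgebraic_of_span_chernCharacter` modulo the named fact
`span_holomorphicBundleChernCharacter_eq_algebraicClasses`, or `cupProductAlgebraic_of_moving_irreducible`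
modulo Chow's moving lemma). -/
theorem stub_cupProductAlgebraic : CupProductAlgebraic := by
  sorry

/-- **Stub 2 (crux-sized, THE HARDEST; = item stmt-HodgeConjecture-14300 `OrthogonalEnveloped`).** For an
orientation family `μ` with Poincaré duality, `m ∈ {1, 2}`, a datum `D` and a rational Hodge
`(m+1,m+1)`-class `e` cup-orthogonal to the theta world `TW(D)`, some `γ ∈ algebraicClasses (X ⊗ X) (2(m+1))`
acts by `P β = pr₁₊(pr₂* β ∪ γ)` preserving rational classes, with purely `(m+1,m+1)` image and `P e = e`.
HC-implied (landed `Theorems/OrthogonalEnveloped/Negative/EnvelopeOfAlgebraic`); reduced by its crux chain to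
the bet `CoreVanishing` (landed `orthogonalEnveloped_of_coreVanishing :
Grothendieck1969_supportedClasses_le_hodgeConiveau → CupProductAlgebraic → CoreVanishing → OrthogonalEnveloped`). -/
theorem stub_orthogonalEnveloped : OrthogonalEnveloped := by
  sorry

/-- **The composition (no `sorry`): the crux from its two open pieces.**  The landed three-piece glue
`algebraicOrEnvelopedOfSplit_proof` with its Hodge-theoretic middle piece discharged by the landed theorem
`orthogonalSplit_proof`. -/
theorem AlgebraicOrEnveloped_of :
    CupProductAlgebraic → OrthogonalEnveloped →
      Summit.HodgeConjecture.HodgeConjecture.Theses.EndoscopicMiddleDegree.AlgebraicOrEnveloped := by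
  intro hcup henv
  have hglue : CupProductAlgebraic → OrthogonalSplit → OrthogonalEnveloped → AlgebraicOrEnveloped :=
    algebraicOrEnvelopedOfSplit_proof
  exact hglue hcup orthogonalSplit_proof henv

/-- The crux BY NAME from the two stubs. -/
theorem AlgebraicOrEnveloped_holds :
    Summit.HodgeConjecture.HodgeConjecture.Theses.EndoscopicMiddleDegree.AlgebraicOrEnveloped :=
  AlgebraicOrEnveloped_of stub_cupProductAlgebraic stub_orthogonalEnveloped

end Summit.HodgeConjecture.HodgeConjecture.Cruxes.AlgebraicOrEnveloped.PiecesSplit
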